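import Summits.ValiantsHypothesis.ValiantsHypothesis.Theses.DetQP
import Summits.ValiantsHypothesis.ValiantsHypothesis.Theses.UlrichPadded
import Literature.Computability.AlgebraicComplexity.DeterminantalComplexityProofs
import Literature.Computability.AlgebraicComplexity.StandardFamiliesProofs
import Summits.ValiantsHypothesis.ValiantsHypothesis.Theorems.DetqpThesis.Negative.NotQPBoundedOfExp
import Summits.ValiantsHypothesis.ValiantsHypothesis.Theorems.DetQPDetqpThesisStubNormalForm
import Summits.ValiantsHypothesis.ValiantsHypothesis.Theorems.DetQPDetqpThesisStubDeletion
import Summits.ValiantsHypothesis.ValiantsHypothesis.Theorems.DetQPDetqpThesisStubTelescope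
import Summits.ValiantsHypothesis.ValiantsHypothesis.Theorems.DetQPDetqpThesisStubGrenetRowPartitioned
import Summits.ValiantsHypothesis.ValiantsHypothesis.Theorems.DetQPDetqpThesisFatBlockCalibration
import Summits.ValiantsHypothesis.ValiantsHypothesis.Theorems.DetQPDetqpThesisFatRowRatio
import Summits.ValiantsHypothesis.ValiantsHypothesis.Theorems.DetQPDetqpThesisFatRowExpLower

/-!
# Line `fat-row-recursion` — skeleton for crux `DetQP.DetqpThesis`
# (stmt-ValiantsHypothesis-0315; routes DetQP (decl `DetqpThesis`) and UlrichPadded (decl `Target`,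
# the same term) — shared item)

Crux (by name): `Summit.ValiantsHypothesis.ValiantsHypothesis.Theses.DetQP.DetqpThesis` =
`¬ IsQPBounded (fun n => determinantalComplexity (perPoly (Fin n) ℂ))` — the Extended Valiant
Hypothesis over `ℂ` in dc form (Cruxes/DetqpThesis/Disproof.lean (F)).

## The line (idea card `Cruxes/DetqpThesis/Ideas/fat-row-recursion.md`, triage r2: 2 × pass)

OBJECTS (all stated INLINE over tree vocabulary in every stub; the local abbreviations `rpSet` / `rp`
below are documentation + glue only and appear in no registered signature).
A ROW-PARTITIONED representation of `per_n` of size `M` is an affine determinantal representation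
`A : Matrix (Fin M) (Fin M) (MvPolynomial (Fin n × Fin n) ℂ)` of `perPoly (Fin n) ℂ`
(`IsAffineDetRepr`) together with `β : Fin M → Fin n` such that matrix row `a` reads only the
variables `x_{•, β a}` of column `β a` of `x`:
`∀ a b e, coeff (Finsupp.single e 1) (A a b) ≠ 0 → e.2 = β a`.
Block `j` = `{a | β a = j}`, of size `u_j = (univ.filter (β · = j)).card`; `r(n) := min M`.

COMPOSITION (`DetqpThesis_of`; skeleton v3 of lead a1: S1, S2, S4 LANDED in wave 1 — the ONLY `sorry`
left is the bet S3; calibration stubs S5, S6, S7 also landed, see below):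
* S1 `stub_normalForm` (Sylvester regrouping by ONE index of `x`; provable, M): every affine
  representation of size `m` yields a row-partitioned one of size `≤ n·m`; hence `r(n) ≤ n·dc(per_n)`
  and (since a row-partitioned representation is a representation) `dc(per_n) ≤ r(n)`, `1 ≤ r(n)`.
* S2 `stub_deletion` (freeze column `j` of `x`; provable, M): from a row-partitioned representation
  of `per_{n+1}` of size `M` and any block `j`, a row-partitioned representation of `per_n` of size
  `≤ M − u_j`; hence `r(n) ≤ r(n+1) − u_max`.
* S3 `stub_fatBlock` (THE BET, ∃-form `IC∃(ε)` as sharpened by both triagers): for some `ε > 0`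
  and all large `n`, SOME minimal row-partitioned representation of `per_n` has a block of size
  `≥ r(n)/n^{1-ε}`.
* S4 `stub_telescope` (real analysis; provable, M): a sequence `r ≥ 1` with
  `r(n+1) ≤ (n+1)^{1-ε}·(r(n+1) − r(n))` eventually grows like `exp(n^ε/ε)`, so any `d` with
  `r ≤ n^k·d` is not quasi-polynomially bounded.
`DetqpThesis_of`: S3 at `n+1` + minimality ⇒ `M = r(n+1)`; S2 ⇒ `r(n) + u_j ≤ r(n+1)`; so the
hypothesis of S4 holds for `r`, and S1 gives `r ≤ n·dc`; S4 ⇒ `¬ IsQPBounded dc` = the crux BY NAME.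

Documentation (NOT stubs, no `sorry`, stated as inline hypotheses of proved lemmas):
`fatBlock_of_forallFat` (`IC∀(ε) ⇒ IC∃(ε)`: the ∀-form is the proof STRATEGY for S3) and
`rung_growth` (the first contentful rung ImbalanceConst(1+δ) — "no minimal row-partitioned
representation is (1+δ)-balanced", triage r2-1 (s2) / r2-2 (iii) — and the constant-scale growth
law it yields via S1 + S2); unconditional calibration `rp_ratio_mono` (`r(n)/n` non-decreasing).

## Disproof.lean used (Cruxes/DetqpThesis/Disproof.lean, cdisprove; no `_false_without_` theorem —
## the crux has no hypothesis)

(A) `char ≠ 2` is load-bearing: consumed by S3 only (over a field of characteristic 2, `per = det`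
is row-partitioned with the balanced profile `(1,…,1)`, `r(n) = n`, so S3 is FALSE there; S1, S2,
S4 are characteristic-free).  (B) family: S3 is false verbatim for `det_n` (profile `(1,…,1)`).
(C) growth: the conclusion of S3+S4 is `dc(per_n) ≥ exp(c·n^ε)/n`, below Grenet's `2^n − 1` for
`ε < 1`; `ε` is existential (typing checklist 4c(iv)).  (E) the output is an EVENTUAL lower bound:
S4 concludes `¬ IsQPBounded` directly (same shape as `Negative.not_isQPBounded_of_eventually_le`,
imported for the lead's convenience).  Negatives 5668 / 0340 / 3735 / 3738: not used (no tightness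
at infinity, no uniqueness of optimal representations is assumed).
-/

set_option linter.unusedVariables false
set_option linter.dupNamespace false

namespace Summit.ValiantsHypothesis.ValiantsHypothesis.Cruxes.DetqpThesis.FatRowRecursion

open MvPolynomial
open scoped BigOperators Matrix
open Literature.Computability.AlgebraicComplexity

noncomputable section

/-! ## Registered stubs (the ONLY places `sorry` may appear) -/

/-- **S1 — row-partition normal form (Sylvester regrouping by the column index of `x`).**
Every affine determinantal representation of `per_n` (`n ≥ 1`) of size `m` yields a ROW-PARTITIONED
one of size `M ≤ n·m`: shift to a point `x⁰` with `per_n(x⁰) ≠ 0` (e.g. `x⁰ = 1`), write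
`A(x⁰ + y) = C·(1_m + Σ_j U_j V_j(y))` with `C = A(x⁰)` invertible, `W_j = Σ_i Im(C⁻¹A_{ij})`,
`U_j` a basis of `W_j` (`u_j = dim W_j ≤ m`), `V_j(y) = Σ_i y_{ij} V_{ij}` linear in `y_{•j}` only;
Sylvester `Matrix.det_one_add_mul_comm` gives `per_n(x⁰+y) = det C · det(1_M + V(y)U)` with
`M = Σ_j u_j ≤ n·m`, row block `j` of `1_M + V(y)U` affine in `y_{•j}` only; substitute back
`y = x − x⁰` (same column classes) and absorb `det C` into one row.  Size M.
(A coarser bound `M ≤ n²·m` follows from the landed `PrincipalMinorColouring.NormalForm`,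
stmt-3779, whose `1_R + diag(x∘κ)K` is row-partitioned with `β = (κ ·).2`; any polynomial factor
suffices for `DetqpThesis_of`, see `stub_telescope`'s parameter `k`.)
[Sylvester; IkenmeyerLandsberg2017 §6; AravindJoglekar2015; Mathlib `Matrix.det_one_add_mul_comm`] -/
theorem stub_normalForm :
    ∀ (n m : ℕ), 1 ≤ n → HasDetRepr (perPoly (Fin n) ℂ) m →
      ∃ M ≤ n * m, ∃ (A : Matrix (Fin M) (Fin M) (MvPolynomial (Fin n × Fin n) ℂ)) (β : Fin M → Fin n),
        IsAffineDetRepr (perPoly (Fin n) ℂ) A ∧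
        ∀ a b (e : Fin n × Fin n), coeff (Finsupp.single e 1) (A a b) ≠ 0 → e.2 = β a :=
  -- S1 LANDED (wave 1, p139378): Theorems/DetQPDetqpThesisStubNormalForm.lean
  Summit.ValiantsHypothesis.ValiantsHypothesis.Theorems.DetQPDetqpThesis.FatRowNormalForm.stub_normalForm

/-- **S2 — deletion of a column block is exact surgery.**  Let `(A, β)` be a row-partitioned
representation of `per_{n+1}` of size `M` (`n ≥ 1`) and `j : Fin (n+1)` a column index of `x`, with
block `B_j = {a | β a = j}` of size `u_j`.  Substitute `x_{i,j} := [i = i₀]` (any fixed row `i₀`):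
`per_{n+1} ↦ per_n(minor_{i₀ j})` exactly (no dependence on `x_{i₀,•}` survives), the rows `a ∈ B_j`
become CONSTANT (they read `x_{•j}` only, and are affine), they form a `u_j × M` constant strip of
full rank (else `det ≡ 0 ≠ per_n`), a constant column gauge `Q ∈ GL_M(ℂ)` turns the strip into
`[1 | 0]` WITHOUT mixing row blocks (column operations act inside each row), and the complementary
`(M − u_j) × (M − u_j)` block `T` is affine, row-partitioned over the remaining `n` columns, with
`det T = (± det Q) · per_n(minor)`; rename the surviving variables to `Fin n × Fin n` (send
`x_{i₀,•} ↦ 0`) and absorb the unit into one row.  Hence `r(n) ≤ r(n+1) − u_j` for every block of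
every row-partitioned representation.  Verified exactly on Grenet's representations for
`n + 1 = 3, 4` and every block by both triagers.  Size M.
[Schur complement / Laplace; Mathlib `Matrix.det_fromBlocks₂₂`, `MvPolynomial.rename`, `aeval`] -/
theorem stub_deletion :
    ∀ (n : ℕ), 1 ≤ n →
      ∀ (M : ℕ) (A : Matrix (Fin M) (Fin M) (MvPolynomial (Fin (n + 1) × Fin (n + 1)) ℂ))
        (β : Fin M → Fin (n + 1)),
        IsAffineDetRepr (perPoly (Fin (n + 1)) ℂ) A →
        (∀ a b (e : Fin (n + 1) × Fin (n + 1)), coeff (Finsupp.single e 1) (A a b) ≠ 0 → e.2 = β a) →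
        ∀ j : Fin (n + 1),
          ∃ M' : ℕ, M' + (Finset.univ.filter fun a => β a = j).card ≤ M ∧
            ∃ (A' : Matrix (Fin M') (Fin M') (MvPolynomial (Fin n × Fin n) ℂ)) (β' : Fin M' → Fin n),
              IsAffineDetRepr (perPoly (Fin n) ℂ) A' ∧
              ∀ a b (e : Fin n × Fin n), coeff (Finsupp.single e 1) (A' a b) ≠ 0 → e.2 = β' a :=
  -- S2 LANDED (wave 1, p139583): Theorems/DetQPDetqpThesisStubDeletion.lean
  Summit.ValiantsHypothesis.ValiantsHypothesis.Theorems.DetQPDetqpThesis.FatRowDeletion.stub_deletion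

/-- **S3 — THE BET `IC∃(ε)`: some minimal row-partitioned representation has a fat block.**
There are `ε > 0` and `n₀` such that for every `n ≥ n₀` SOME row-partitioned representation
`(A, β)` of `per_n` of MINIMAL size `M = r(n)` (no row-partitioned representation of any smaller
size exists) has a block `B_j` with `u_j ≥ M / n^{1-ε}` — imbalance exponent `ε` (the average block
is `M/n`).  Calibration: false at `n = 2` (`r(2) = 2`, forced profile `(1,1)`), holds at `n = 3`
(`r(3) = dc(per_3) = 7`, Grenet₇ is row-partitioned with profile `(1,3,3)`) iff `ε ≤ log₃(9/7)`;
Grenet's representation has `u_max/M ≈ 0.8/√n`, i.e. exponent `→ 1/2`; `det_n = det(0 + X)` has the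
balanced profile `(1,…,1)` (so the statement is false for `det` and in characteristic 2: Disproof
(A)/(B) honoured — the bet is a 'signs cannot rebalance cheaply' statement about the permanent).
Why it might fail: nothing beyond Grenet supports any imbalance above pigeonhole (triage r2-2 (b));
a size-preserving rebalancing surgery on row-partitioned representations would kill it for all `n`
at once (triage r2-1 (s3): the disprover's first target).  The ∀-form (hypothesis of `fatBlock_of_forallFat` below) is
the intended proof strategy (minimality ⇒ no constant rows, joint images full; multi-affinity of
`det` in each block's variables).  Size XL (the crux of the line).
[Grenet2011; LandsbergRessayre2017 (calibration ε = 1/2); MignonRessayre2004; Nisan1991;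
IkenmeyerLandsberg2017 Thm 2.9 (structural theorems about ALL determinantal expressions of per exist)] -/
theorem stub_fatBlock :
    ∃ ε : ℝ, 0 < ε ∧ ∃ n₀ : ℕ, ∀ n ≥ n₀,
      ∃ (M : ℕ) (A : Matrix (Fin M) (Fin M) (MvPolynomial (Fin n × Fin n) ℂ)) (β : Fin M → Fin n),
        IsAffineDetRepr (perPoly (Fin n) ℂ) A ∧
        (∀ a b (e : Fin n × Fin n), coeff (Finsupp.single e 1) (A a b) ≠ 0 → e.2 = β a) ∧
        (∀ M' < M, ¬ ∃ (A' : Matrix (Fin M') (Fin M') (MvPolynomial (Fin n × Fin n) ℂ))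
            (β' : Fin M' → Fin n),
            IsAffineDetRepr (perPoly (Fin n) ℂ) A' ∧
            ∀ a b (e : Fin n × Fin n), coeff (Finsupp.single e 1) (A' a b) ≠ 0 → e.2 = β' a) ∧
        ∃ j : Fin n, (M : ℝ) ≤ (n : ℝ) ^ (1 - ε) * ((Finset.univ.filter fun a => β a = j).card : ℝ) := by
  sorry

/-- **S4 — telescoping: a fat-increment recursion forces super-quasi-polynomial growth.**
Pure real analysis, no algebra: if `r ≥ 1` and `r(n+1) ≤ (n+1)^{1-ε} · (r(n+1) − r(n))` for all
`n ≥ n₀` (i.e. `r(n) ≤ (1 − (n+1)^{ε-1})·r(n+1)`), then for `0 < ε < 1`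
`r(N) ≥ r(n₀)·∏ (1 − k^{ε-1})⁻¹ ≥ exp(Σ_{n₀<k≤N} k^{ε-1}) ≥ exp((N^ε − (n₀+1)^ε)/ε)`
(`1/(1−x) ≥ eˣ` on `[0,1)`, `Σ k^{ε-1} ≥ ∫ x^{ε-1}`), and `exp(N^ε/ε − C − k·log N)` exceeds
every `2^{(log₂ N + c)^c}` for large `N` (`log^c N = o(N^ε)`), so `d ≥ r/n^k` is not qp-bounded;
for `ε ≥ 1` the hypotheses are contradictory (`r(n) ≤ 0`).  Size M (Mathlib: `Real.rpow`,
`Real.add_pow_le_pow_mul_pow_of_nonneg`/integral comparison `AntitoneOn.integral_le_sum`,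
`isLittleO_log_rpow_atTop`-type asymptotics).  [folklore; the shape of
`Negative.not_isQPBounded_of_eventually_le`] -/
theorem stub_telescope :
    ∀ (k : ℕ) (r d : ℕ → ℕ) (ε : ℝ), 0 < ε → ∀ n₀ : ℕ,
      (∀ n ≥ n₀, 1 ≤ r n) →
      (∀ n ≥ n₀, r n ≤ n ^ k * d n) →
      (∀ n ≥ n₀, (r (n + 1) : ℝ) ≤ ((n + 1 : ℕ) : ℝ) ^ (1 - ε) * ((r (n + 1) : ℝ) - (r n : ℝ))) →
      ¬ IsQPBounded d :=
  -- S4 LANDED (wave 1, p139361): Theorems/DetQPDetqpThesisStubTelescope.lean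
  Summit.ValiantsHypothesis.ValiantsHypothesis.Theorems.DetQPDetqpThesis.FatRowTelescope.stub_telescope

/-- **S5 — calibration stub (lead a1 reshape, 2026-08-17): Grenet's representation is
row-partitioned with the binomial profile.**  Grenet's `(2ⁿ − 1) × (2ⁿ − 1)` affine matrix for
`per_n` (tree: `determinantalComplexity_perPoly_le_holds`, the minor of `1 − A` for the weighted
adjacency matrix `A` of the subset lattice, arc `S → insert j S` of weight `X (j, |S|)`, row `univ`
and column `∅` deleted, times a sign) has matrix row `S` (`S ≠ univ`) reading only the variables
`X (j, |S|)`, i.e. it is row-partitioned with `β S = |S|`, and block `c` consists of the subsets of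
cardinality `c < n`, of size `C(n, c)`.  Consequences (proved below from S5): `r(n) ≤ 2ⁿ − 1`, and the
upper sandwich of the bet: if Grenet is eventually dc-optimal then S3 holds for every `ε < 1/2`
(`fatBlock_of_grenetTight`, with the central-binomial estimate).  NOT in the cone of
`DetqpThesis_of` (calibration only).  Size M.  [Grenet2011, Thm. 1; LandsbergRessayre2017 §2.2] -/
theorem stub_grenetRowPartitioned :
    ∀ n : ℕ, 1 ≤ n →
      ∃ (A : Matrix (Fin (2 ^ n - 1)) (Fin (2 ^ n - 1)) (MvPolynomial (Fin n × Fin n) ℂ))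
        (β : Fin (2 ^ n - 1) → Fin n),
        IsAffineDetRepr (perPoly (Fin n) ℂ) A ∧
        (∀ a b (e : Fin n × Fin n), coeff (Finsupp.single e 1) (A a b) ≠ 0 → e.2 = β a) ∧
        ∀ c : Fin n, (Finset.univ.filter fun a => β a = c).card = n.choose c :=
  -- S5 LANDED (wave 1, p139280): Theorems/DetQPDetqpThesisStubGrenetRowPartitioned.lean
  Summit.ValiantsHypothesis.ValiantsHypothesis.Theorems.DetQPDetqpThesis.FatRowGrenet.stub_grenetRowPartitioned

/-- **S6 — calibration stub (lead a1 reshape v3, 2026-08-17): the bet from ABOVE.**  If for all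
large `n` there is NO row-partitioned representation of `per_n` of size `< 2ⁿ − 1` (eventual
Grenet-tightness inside the row-partitioned class — implied by eventual Grenet dc-optimality
`2ⁿ − 1 ≤ dc(per_n)`, the `GrenetRigidity` scenario), then for EVERY `ε < 1/2` and all large `n`
the matrix of the bet S3 holds: Grenet's own representation (S5) is then minimal and its middle
block `C(n, ⌊n/2⌋) ≥ 2ⁿ/√(8n)` is fat (`4ⁿ ≤ 8n·C(n,⌊n/2⌋)²`, elementary).  So the ∃-form of the
bet is irrefutable short of refuting eventual Grenet-optimality in the rp class; with the lower
sandwich (`rp_exp_lower_of_growth`: the bet forces `r(N) ≥ exp(((N+1)^ε − C)/ε)`) it is calibrated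
as an exponential-regime statement on both sides.  NOT in the cone of `DetqpThesis_of`.  Size S.
[Grenet2011; LandsbergRessayre2017 §2.2] -/
theorem stub_fatBlock_of_grenetTight :
    (∃ n₁ : ℕ, ∀ n ≥ n₁, ∀ M < 2 ^ n - 1,
        ¬ ∃ (A : Matrix (Fin M) (Fin M) (MvPolynomial (Fin n × Fin n) ℂ)) (β : Fin M → Fin n),
          IsAffineDetRepr (perPoly (Fin n) ℂ) A ∧
          ∀ a b (e : Fin n × Fin n), coeff (Finsupp.single e 1) (A a b) ≠ 0 → e.2 = β a) →
    ∀ ε : ℝ, ε < 1 / 2 → ∃ n₀ : ℕ, ∀ n ≥ n₀,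
      ∃ (M : ℕ) (A : Matrix (Fin M) (Fin M) (MvPolynomial (Fin n × Fin n) ℂ)) (β : Fin M → Fin n),
        IsAffineDetRepr (perPoly (Fin n) ℂ) A ∧
        (∀ a b (e : Fin n × Fin n), coeff (Finsupp.single e 1) (A a b) ≠ 0 → e.2 = β a) ∧
        (∀ M' < M, ¬ ∃ (A' : Matrix (Fin M') (Fin M') (MvPolynomial (Fin n × Fin n) ℂ))
            (β' : Fin M' → Fin n),
            IsAffineDetRepr (perPoly (Fin n) ℂ) A' ∧
            ∀ a b (e : Fin n × Fin n), coeff (Finsupp.single e 1) (A' a b) ≠ 0 → e.2 = β' a) ∧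
        ∃ j : Fin n, (M : ℝ) ≤ (n : ℝ) ^ (1 - ε) * ((Finset.univ.filter fun a => β a = j).card : ℝ) :=
  -- S6 LANDED (lead a1, p139799): Theorems/DetQPDetqpThesisFatBlockCalibration.lean
  Summit.ValiantsHypothesis.ValiantsHypothesis.Theorems.DetQPDetqpThesis.FatRowCalibration.stub_fatBlock_of_grenetTight

/-- **S7 — the line's unconditional theorem in tree vocabulary (lead a1 reshape v3): ratio
surgery.**  Every row-partitioned representation of `per_{n+1}` of size `M` (`n ≥ 1`) yields a
row-partitioned representation of `per_n` of size `M'` with `(n+1)·M' ≤ n·M`: delete the LARGEST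
column block (pigeonhole `(n+1)·u_max ≥ M`, then S2).  This is `rp_ratio_mono` (`r(n)/n` is
non-decreasing) without the local `rp` abbreviation, so that it can live under `Theorems/`; with
`dc(per_3) = 7` it gives e.g. "no row-partitioned representation of `per_4` has size `≤ 9`".
NOT in the cone of `DetqpThesis_of`.  Size S (given S2). [folklore] -/
theorem stub_ratioSurgery :
    ∀ (n : ℕ), 1 ≤ n →
      ∀ (M : ℕ) (A : Matrix (Fin M) (Fin M) (MvPolynomial (Fin (n + 1) × Fin (n + 1)) ℂ))
        (β : Fin M → Fin (n + 1)),
        IsAffineDetRepr (perPoly (Fin (n + 1)) ℂ) A →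
        (∀ a b (e : Fin (n + 1) × Fin (n + 1)), coeff (Finsupp.single e 1) (A a b) ≠ 0 → e.2 = β a) →
        ∃ M' : ℕ, (n + 1) * M' ≤ n * M ∧
          ∃ (A' : Matrix (Fin M') (Fin M') (MvPolynomial (Fin n × Fin n) ℂ)) (β' : Fin M' → Fin n),
            IsAffineDetRepr (perPoly (Fin n) ℂ) A' ∧
            ∀ a b (e : Fin n × Fin n), coeff (Finsupp.single e 1) (A' a b) ≠ 0 → e.2 = β' a :=
  -- S7 LANDED (lead a1, p139894): Theorems/DetQPDetqpThesisFatRowRatio.lean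
  Summit.ValiantsHypothesis.ValiantsHypothesis.Theorems.DetQPDetqpThesis.FatRowRatio.stub_ratioSurgery

/-- **S8 — calibration stub (lead a1 reshape v3): the bet from BELOW, in tree vocabulary.**
The registered bet S3 (verbatim, as hypothesis) implies, for some `0 < ε ≤ 1` and `n₀`, the
EVENTUAL bound `exp(((N+1)^ε − (n₀+1)^ε)/ε) ≤ N · dc(per_N)` for all `N ≥ n₀` — the line's own
composition (S3-minimality + S2 ⇒ growth law for `r`; S4's telescoping lemma; S1's `r ≤ N·dc`)
run without the local `rp` abbreviation so that it lands under `Theorems/`.  An `exp(N^ε)` lower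
bound for `dc(per)` is far beyond every known engine (record: Mignon–Ressayre `n²/2`), which is the
kernel-checked reason why S3 is the whole crux of this line.  NOT in the cone of `DetqpThesis_of`.
Size S (given S1, S2, S4). [folklore] -/
theorem stub_expLower_of_fatBlock :
    (∃ ε : ℝ, 0 < ε ∧ ∃ n₀ : ℕ, ∀ n ≥ n₀,
      ∃ (M : ℕ) (A : Matrix (Fin M) (Fin M) (MvPolynomial (Fin n × Fin n) ℂ)) (β : Fin M → Fin n),
        IsAffineDetRepr (perPoly (Fin n) ℂ) A ∧
        (∀ a b (e : Fin n × Fin n), coeff (Finsupp.single e 1) (A a b) ≠ 0 → e.2 = β a) ∧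
        (∀ M' < M, ¬ ∃ (A' : Matrix (Fin M') (Fin M') (MvPolynomial (Fin n × Fin n) ℂ))
            (β' : Fin M' → Fin n),
            IsAffineDetRepr (perPoly (Fin n) ℂ) A' ∧
            ∀ a b (e : Fin n × Fin n), coeff (Finsupp.single e 1) (A' a b) ≠ 0 → e.2 = β' a) ∧
        ∃ j : Fin n, (M : ℝ) ≤ (n : ℝ) ^ (1 - ε) * ((Finset.univ.filter fun a => β a = j).card : ℝ)) →
    ∃ ε : ℝ, 0 < ε ∧ ∃ n₀ : ℕ, ∀ N ≥ n₀,
      Real.exp ((((N : ℝ) + 1) ^ ε - ((n₀ : ℝ) + 1) ^ ε) / ε) ≤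
        (N : ℝ) * (determinantalComplexity (perPoly (Fin N) ℂ) : ℝ) :=
  -- S8 LANDED (lead a1, p140060): Theorems/DetQPDetqpThesisFatRowExpLower.lean
  Summit.ValiantsHypothesis.ValiantsHypothesis.Theorems.DetQPDetqpThesis.FatRowExpLower.stub_expLower_of_fatBlock

/-! ## Local abbreviations (documentation + glue only; no registered signature mentions them) -/

/-- `rpSet n`: the sizes `M` at which `per_n` has a row-partitioned affine determinantal
representation (literally the inline clause of the stubs). -/
def rpSet (n : ℕ) : Set ℕ :=
  {M | ∃ (A : Matrix (Fin M) (Fin M) (MvPolynomial (Fin n × Fin n) ℂ)) (β : Fin M → Fin n),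
    IsAffineDetRepr (perPoly (Fin n) ℂ) A ∧
    ∀ a b (e : Fin n × Fin n), coeff (Finsupp.single e 1) (A a b) ≠ 0 → e.2 = β a}

/-- `rp n = r(n)`: the row-partitioned determinantal complexity of `per_n` (an `sInf`; junk value `0`
never occurs for `n ≥ 1` by `stub_normalForm`). -/
def rp (n : ℕ) : ℕ := sInf (rpSet n)

theorem rp_le {n M : ℕ} (h : M ∈ rpSet n) : rp n ≤ M := Nat.sInf_le h

theorem rp_spec {n M : ℕ} (h : M ∈ rpSet n) : rp n ∈ rpSet n := Nat.sInf_mem (s := rpSet n) ⟨M, h⟩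

theorem not_mem_rpSet_of_lt_rp {n M : ℕ} (h : M < rp n) : M ∉ rpSet n := Nat.notMem_of_lt_sInf h

/-- A row-partitioned representation is a representation: `dc(per_n) ≤ M`. -/
theorem hasDetRepr_of_mem_rpSet {n M : ℕ} (h : M ∈ rpSet n) : HasDetRepr (perPoly (Fin n) ℂ) M := by
  obtain ⟨A, β, hA, -⟩ := h
  exact ⟨A, hA⟩

/-- S1 ⇒ `r(n)` is attained and `r(n) ≤ n · dc(per_n)` (`n ≥ 1`). -/
theorem rp_attained_le {n : ℕ} (hn : 1 ≤ n) :
    rp n ∈ rpSet n ∧ rp n ≤ n * determinantalComplexity (perPoly (Fin n) ℂ) := by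
  obtain ⟨M, hM, hRP⟩ := stub_normalForm n (determinantalComplexity (perPoly (Fin n) ℂ)) hn
    (hasDetRepr_determinantalComplexity_holds _)
  exact ⟨rp_spec hRP, (rp_le hRP).trans hM⟩

/-- `n ≤ dc(per_n) ≤ r(n)`, in particular `1 ≤ r(n)` for `n ≥ 1`. -/
theorem le_rp {n : ℕ} (hn : 1 ≤ n) : n ≤ rp n := by
  have h1 : determinantalComplexity (perPoly (Fin n) ℂ) ≤ rp n :=
    determinantalComplexity_le_of_hasDetRepr (hasDetRepr_of_mem_rpSet (rp_attained_le hn).1)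
  have h2 : n ≤ determinantalComplexity (perPoly (Fin n) ℂ) := by
    have h := totalDegree_le_determinantalComplexity_holds (perPoly (Fin n) ℂ)
    rwa [totalDegree_perPoly_holds, Fintype.card_fin] at h
  exact h2.trans h1

/-- S2 + S3 ⇒ the growth law `G(ε)`: `r(n+1) ≤ (n+1)^{1-ε} · (r(n+1) − r(n))` for `n ≥ n₀`, `n ≥ 1`. -/
theorem growth_law :
    ∃ ε : ℝ, 0 < ε ∧ ∃ n₀ : ℕ, ∀ n ≥ n₀,
      (rp (n + 1) : ℝ) ≤ ((n + 1 : ℕ) : ℝ) ^ (1 - ε) * ((rp (n + 1) : ℝ) - (rp n : ℝ)) := by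
  obtain ⟨ε, hε, n₀, hfat⟩ := stub_fatBlock
  refine ⟨ε, hε, n₀ + 1, fun n hn => ?_⟩
  obtain ⟨M, A, β, hA, hβ, hmin, j, hj⟩ := hfat (n + 1) (by omega)
  have hRP : M ∈ rpSet (n + 1) := ⟨A, β, hA, hβ⟩
  have hle : rp (n + 1) ≤ M := rp_le hRP
  have hge : M ≤ rp (n + 1) := by
    by_contra hlt
    push Not at hlt
    exact hmin (rp (n + 1)) hlt (rp_spec hRP)
  have hM : rp (n + 1) = M := le_antisymm hle hge
  obtain ⟨M', hM', hRP'⟩ := stub_deletion n (by omega) M A β hA hβ j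
  have hrn : rp n ≤ M' := rp_le hRP'
  have hsum : rp n + (Finset.univ.filter fun a => β a = j).card ≤ rp (n + 1) := by omega
  have hcast : ((Finset.univ.filter fun a => β a = j).card : ℝ) ≤ (rp (n + 1) : ℝ) - (rp n : ℝ) := by
    have h := (Nat.cast_le (α := ℝ)).mpr hsum
    push_cast at h
    linarith
  have hpow : (0 : ℝ) ≤ ((n + 1 : ℕ) : ℝ) ^ (1 - ε) := Real.rpow_nonneg (Nat.cast_nonneg _) _
  calc (rp (n + 1) : ℝ) = (M : ℝ) := by rw [hM]
    _ ≤ ((n + 1 : ℕ) : ℝ) ^ (1 - ε) * ((Finset.univ.filter fun a => β a = j).card : ℝ) := hj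
    _ ≤ ((n + 1 : ℕ) : ℝ) ^ (1 - ε) * ((rp (n + 1) : ℝ) - (rp n : ℝ)) :=
        mul_le_mul_of_nonneg_left hcast hpow

/-! ## Composition: the line concludes the crux BY NAME (modulo the stubs) -/

/-- **The line concludes the crux** `DetQP.DetqpThesis`: S3 —S2→ growth law —S4 (with S1:
`1 ≤ r ≤ n·dc`)→ `¬ IsQPBounded (n ↦ dc(per_n))`. -/
theorem DetqpThesis_of :
    Summit.ValiantsHypothesis.ValiantsHypothesis.Theses.DetQP.DetqpThesis := by
  obtain ⟨ε, hε, n₀, hG⟩ := growth_law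
  have h1 : ∀ n ≥ n₀ + 1, 1 ≤ rp n := fun n hn =>
    (Nat.one_le_iff_ne_zero.mpr (by omega : n ≠ 0)).trans (le_rp (by omega))
  have h2 : ∀ n ≥ n₀ + 1, rp n ≤ n ^ 1 * determinantalComplexity (perPoly (Fin n) ℂ) := by
    intro n hn
    rw [pow_one]
    exact (rp_attained_le (by omega)).2
  have h3 : ∀ n ≥ n₀ + 1,
      (rp (n + 1) : ℝ) ≤ ((n + 1 : ℕ) : ℝ) ^ (1 - ε) * ((rp (n + 1) : ℝ) - (rp n : ℝ)) :=
    fun n hn => hG n (by omega)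
  exact stub_telescope 1 rp (fun n => determinantalComplexity (perPoly (Fin n) ℂ)) ε hε (n₀ + 1)
    h1 h2 h3

/-- The shared item's other name, BY NAME: route UlrichPadded's `Target` (payload route_id) is the
same term. -/
theorem Target_of :
    Summit.ValiantsHypothesis.ValiantsHypothesis.Theses.UlrichPadded.Target :=
  DetqpThesis_of

/-! ## Unconditional consequences of S1 + S2 (calibration; no bet involved) -/

/-- `r(n) + u_j ≤ … `: every block of every row-partitioned representation of `per_{n+1}` of size
`M` satisfies `r(n) + u_j ≤ M` (S2). -/
theorem rp_add_card_le {n M : ℕ} (hn : 1 ≤ n)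
    (A : Matrix (Fin M) (Fin M) (MvPolynomial (Fin (n + 1) × Fin (n + 1)) ℂ)) (β : Fin M → Fin (n + 1))
    (hA : IsAffineDetRepr (perPoly (Fin (n + 1)) ℂ) A)
    (hβ : ∀ a b (e : Fin (n + 1) × Fin (n + 1)), coeff (Finsupp.single e 1) (A a b) ≠ 0 → e.2 = β a)
    (j : Fin (n + 1)) :
    rp n + (Finset.univ.filter fun a => β a = j).card ≤ M := by
  obtain ⟨M', hM', hRP'⟩ := stub_deletion n hn M A β hA hβ j
  have := rp_le hRP'
  omega

/-- **`r(n)/n` is non-decreasing** (S1 + S2 + pigeonhole): `(n+1)·r(n) ≤ n·r(n+1)` for `n ≥ 1`.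
With `r(3) = 7` (Grenet₇ is row-partitioned, `dc(per_3) = 7`) this gives the unconditional floors
`r(4) ≥ 10`, `r(5) ≥ 13`, `r(6) ≥ 16` quoted by the triagers. -/
theorem rp_ratio_mono {n : ℕ} (hn : 1 ≤ n) : (n + 1) * rp n ≤ n * rp (n + 1) := by
  obtain ⟨⟨A, β, hA, hβ⟩, -⟩ := rp_attained_le (n := n + 1) (by omega)
  -- pigeonhole: some block has `(n+1) · u_j ≥ r(n+1)`
  have hsum : ∑ j : Fin (n + 1), (Finset.univ.filter fun a => β a = j).card = rp (n + 1) := by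
    have h := Finset.card_eq_sum_card_fiberwise (f := β) (s := Finset.univ) (t := Finset.univ)
      (fun a _ => Finset.mem_univ (β a))
    simpa using h.symm
  obtain ⟨j, -, hj⟩ : ∃ j ∈ (Finset.univ : Finset (Fin (n + 1))),
      rp (n + 1) ≤ (n + 1) * (Finset.univ.filter fun a => β a = j).card := by
    by_contra hcon
    push Not at hcon
    have hlt : ∑ j : Fin (n + 1), (n + 1) * (Finset.univ.filter fun a => β a = j).card <
        ∑ _j : Fin (n + 1), rp (n + 1) :=
      Finset.sum_lt_sum_of_nonempty Finset.univ_nonempty fun j hj => hcon j hj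
    rw [← Finset.mul_sum, hsum, Finset.sum_const, Finset.card_univ, Fintype.card_fin,
      smul_eq_mul] at hlt
    exact lt_irrefl _ hlt
  have hdel := rp_add_card_le hn A β hA hβ j
  nlinarith

/-- S5 ⇒ **`r(n) ≤ 2ⁿ − 1`** for `n ≥ 1` (Grenet's representation is row-partitioned): the line
claims no super-Grenet growth (Disproof (C)). -/
theorem rp_le_grenet {n : ℕ} (hn : 1 ≤ n) : rp n ≤ 2 ^ n - 1 := by
  obtain ⟨A, β, hA, hβ, -⟩ := stub_grenetRowPartitioned n hn
  exact rp_le ⟨A, β, hA, hβ⟩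

/-! ## Calibration of the bet S3 (sandwich between two exponential-regime statements) -/

/-- **Upper sandwich: eventual Grenet-tightness in the rp class ⇒ the bet S3** (verbatim the
registered signature of `stub_fatBlock`, with `ε = 1/4`), by S6.  Hence the ∃-form of the bet is
consistent relative to "`r(n) = 2ⁿ − 1` for all large `n`" and cannot be refuted without refuting
that. -/
theorem fatBlock_of_grenetTight
    (h : ∃ n₁ : ℕ, ∀ n ≥ n₁, ∀ M < 2 ^ n - 1, M ∉ rpSet n) :
    ∃ ε : ℝ, 0 < ε ∧ ∃ n₀ : ℕ, ∀ n ≥ n₀,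
      ∃ (M : ℕ) (A : Matrix (Fin M) (Fin M) (MvPolynomial (Fin n × Fin n) ℂ)) (β : Fin M → Fin n),
        IsAffineDetRepr (perPoly (Fin n) ℂ) A ∧
        (∀ a b (e : Fin n × Fin n), coeff (Finsupp.single e 1) (A a b) ≠ 0 → e.2 = β a) ∧
        (∀ M' < M, ¬ ∃ (A' : Matrix (Fin M') (Fin M') (MvPolynomial (Fin n × Fin n) ℂ))
            (β' : Fin M' → Fin n),
            IsAffineDetRepr (perPoly (Fin n) ℂ) A' ∧
            ∀ a b (e : Fin n × Fin n), coeff (Finsupp.single e 1) (A' a b) ≠ 0 → e.2 = β' a) ∧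
        ∃ j : Fin n, (M : ℝ) ≤ (n : ℝ) ^ (1 - ε) * ((Finset.univ.filter fun a => β a = j).card : ℝ) :=
  ⟨1 / 4, by norm_num, stub_fatBlock_of_grenetTight h (1 / 4) (by norm_num)⟩

/-- Eventual Grenet dc-optimality (`2ⁿ − 1 ≤ dc(per_n)` for large `n`, the hypothesis of
`Negative.detqpThesis_of_eventually_grenet_tight`) implies eventual Grenet-tightness in the rp
class (a row-partitioned representation is a representation). -/
theorem grenetRpTight_of_dcTight
    (h : ∃ n₁ : ℕ, ∀ n ≥ n₁, 2 ^ n - 1 ≤ determinantalComplexity (perPoly (Fin n) ℂ)) :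
    ∃ n₁ : ℕ, ∀ n ≥ n₁, ∀ M < 2 ^ n - 1, M ∉ rpSet n := by
  obtain ⟨n₁, hdc⟩ := h
  refine ⟨n₁, fun n hn M hM hRP => ?_⟩
  have hle := determinantalComplexity_le_of_hasDetRepr (hasDetRepr_of_mem_rpSet hRP)
  have := hdc n hn
  omega

/-- **Lower sandwich: the growth law forces `r(N) ≥ exp(((N+1)^ε − (n₀+1)^ε)/ε)`** for
`0 < ε ≤ 1`, `1 ≤ n₀ ≤ N` (the telescoping inequality `FatRowTelescope.exp_telescope_le` landed with
S4, applied to `r = rp`, `1 ≤ rp n₀` by S1).  With `growth_law` (S2 + S3) and `rp ≤ n·dc` (S1) this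
is the exponential-type lower bound `dc(per_N) ≥ exp(((N+1)^ε − C)/ε)/N` that the bet entails —
far beyond every known dc engine (Mignon–Ressayre `n²/2`), which is why S3 is the whole crux of the
line and not a stub a prover can close. -/
theorem rp_exp_lower_of_growth {ε : ℝ} (hε : 0 < ε) (hε1 : ε ≤ 1) {n₀ : ℕ} (hn₀ : 1 ≤ n₀)
    (hG : ∀ n ≥ n₀, (rp (n + 1) : ℝ) ≤ ((n + 1 : ℕ) : ℝ) ^ (1 - ε) * ((rp (n + 1) : ℝ) - (rp n : ℝ))) :
    ∀ N ≥ n₀, Real.exp ((((N : ℝ) + 1) ^ ε - ((n₀ : ℝ) + 1) ^ ε) / ε) ≤ rp N :=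
  Summit.ValiantsHypothesis.ValiantsHypothesis.Theorems.DetQPDetqpThesis.FatRowTelescope.exp_telescope_le
    rp hε hε1 n₀ ((Nat.one_le_iff_ne_zero.mpr (by omega)).trans (le_rp hn₀)) hG

/-- **Lower sandwich BY NAME: the registered bet `stub_fatBlock` ⇒ an `exp(N^ε)`-type eventual
lower bound for `dc(per_N)`** (S8 applied to S3; `sorry` only through S3 itself). -/
theorem expLower_of_fatBlock :
    ∃ ε : ℝ, 0 < ε ∧ ∃ n₀ : ℕ, ∀ N ≥ n₀,
      Real.exp ((((N : ℝ) + 1) ^ ε - ((n₀ : ℝ) + 1) ^ ε) / ε) ≤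
        (N : ℝ) * (determinantalComplexity (perPoly (Fin N) ℂ) : ℝ) :=
  stub_expLower_of_fatBlock stub_fatBlock

/-- **Sandwich consistency BY NAME** (sorry-free): the upper sandwich's conclusion
(`fatBlock_of_grenetTight`) is literally the bet's statement, since it feeds S8 exactly as
`stub_fatBlock` does in `expLower_of_fatBlock`; so `GrenetTight ⇒ S3 ⇒ ExpLower` composes. -/
theorem expLower_of_grenetTight (h : ∃ n₁ : ℕ, ∀ n ≥ n₁, ∀ M < 2 ^ n - 1, M ∉ rpSet n) :
    ∃ ε : ℝ, 0 < ε ∧ ∃ n₀ : ℕ, ∀ N ≥ n₀,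
      Real.exp ((((N : ℝ) + 1) ^ ε - ((n₀ : ℝ) + 1) ^ ε) / ε) ≤
        (N : ℝ) * (determinantalComplexity (perPoly (Fin N) ℂ) : ℝ) :=
  stub_expLower_of_fatBlock (fatBlock_of_grenetTight h)

/-! ## The proof strategy behind S3 (documentation; not registered, no `sorry`) -/

/-- **`IC∀(ε) ⇒ IC∃(ε)`.**  The hypothesis is `IC∀(ε)`: EVERY minimal row-partitioned representation
of `per_n` (`n ≥ n₀`) has a block of size `≥ M/n^{1-ε}` — the form a structural proof (minimality ⇒
no constant rows and full joint images; multi-affinity of `det` in each block's variables) would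
deliver; the conclusion is verbatim the registered bet `stub_fatBlock` (its ∃-form, triage r2-1 (s1),
r2-2 (i)), using only S1 (minimal representations exist for `n ≥ 1`). -/
theorem fatBlock_of_forallFat
    (h : ∃ ε : ℝ, 0 < ε ∧ ∃ n₀ : ℕ, ∀ n ≥ n₀,
      ∀ (M : ℕ) (A : Matrix (Fin M) (Fin M) (MvPolynomial (Fin n × Fin n) ℂ)) (β : Fin M → Fin n),
        IsAffineDetRepr (perPoly (Fin n) ℂ) A →
        (∀ a b (e : Fin n × Fin n), coeff (Finsupp.single e 1) (A a b) ≠ 0 → e.2 = β a) →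
        (∀ M' < M, ¬ ∃ (A' : Matrix (Fin M') (Fin M') (MvPolynomial (Fin n × Fin n) ℂ))
            (β' : Fin M' → Fin n),
            IsAffineDetRepr (perPoly (Fin n) ℂ) A' ∧
            ∀ a b (e : Fin n × Fin n), coeff (Finsupp.single e 1) (A' a b) ≠ 0 → e.2 = β' a) →
        ∃ j : Fin n, (M : ℝ) ≤ (n : ℝ) ^ (1 - ε) * ((Finset.univ.filter fun a => β a = j).card : ℝ)) :
    ∃ ε : ℝ, 0 < ε ∧ ∃ n₀ : ℕ, ∀ n ≥ n₀,
      ∃ (M : ℕ) (A : Matrix (Fin M) (Fin M) (MvPolynomial (Fin n × Fin n) ℂ)) (β : Fin M → Fin n),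
        IsAffineDetRepr (perPoly (Fin n) ℂ) A ∧
        (∀ a b (e : Fin n × Fin n), coeff (Finsupp.single e 1) (A a b) ≠ 0 → e.2 = β a) ∧
        (∀ M' < M, ¬ ∃ (A' : Matrix (Fin M') (Fin M') (MvPolynomial (Fin n × Fin n) ℂ))
            (β' : Fin M' → Fin n),
            IsAffineDetRepr (perPoly (Fin n) ℂ) A' ∧
            ∀ a b (e : Fin n × Fin n), coeff (Finsupp.single e 1) (A' a b) ≠ 0 → e.2 = β' a) ∧
        ∃ j : Fin n, (M : ℝ) ≤ (n : ℝ) ^ (1 - ε) * ((Finset.univ.filter fun a => β a = j).card : ℝ) := by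
  obtain ⟨ε, hε, n₀, hall⟩ := h
  refine ⟨ε, hε, n₀ + 1, fun n hn => ?_⟩
  obtain ⟨⟨A, β, hA, hβ⟩, -⟩ := rp_attained_le (n := n) (by omega)
  have hmin : ∀ M' < rp n, ¬ ∃ (A' : Matrix (Fin M') (Fin M') (MvPolynomial (Fin n × Fin n) ℂ))
      (β' : Fin M' → Fin n),
      IsAffineDetRepr (perPoly (Fin n) ℂ) A' ∧
      ∀ a b (e : Fin n × Fin n), coeff (Finsupp.single e 1) (A' a b) ≠ 0 → e.2 = β' a :=
    fun M' hM' => not_mem_rpSet_of_lt_rp hM'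
  obtain ⟨j, hj⟩ := hall n (by omega) (rp n) A β hA hβ hmin
  exact ⟨rp n, A, β, hA, hβ, hmin, j, hj⟩

/-- **The first contentful rung `ImbalanceConst(1+δ)` and what it buys** (triage r2-1 (s2),
r2-2 (iii); NOT registered — the lead may register it by a reshape).  Hypothesis (the rung): for
large `n` NO minimal row-partitioned representation of `per_n` is `(1+δ)`-balanced, i.e. every one
has a block of size `≥ (1+δ)·M/n` (`δ = 0` is pigeonhole; at `n = 3` the null-transvection twist of
Grenet₇ — Theorems/GrenetRigidityOptimalUniqueRefutation.lean — shows that balancing the profile to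
`(3,3,3)` costs `+2` in size).  Conclusion (via S1 + S2, exactly as in `growth_law`): the
constant-scale growth law `(1+δ)·r(n+1) ≤ (n+1)·(r(n+1) − r(n))`, i.e. `r(n) ≍ n^{1+δ}` at least —
for `δ > 2` this is route DetQP's crux `DetqpSuperquadratic` (stmt-0318) by the same mechanism. -/
theorem rung_growth
    (h : ∃ δ : ℝ, 0 < δ ∧ ∃ n₀ : ℕ, ∀ n ≥ n₀,
      ∀ (M : ℕ) (A : Matrix (Fin M) (Fin M) (MvPolynomial (Fin n × Fin n) ℂ)) (β : Fin M → Fin n),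
        IsAffineDetRepr (perPoly (Fin n) ℂ) A →
        (∀ a b (e : Fin n × Fin n), coeff (Finsupp.single e 1) (A a b) ≠ 0 → e.2 = β a) →
        (∀ M' < M, ¬ ∃ (A' : Matrix (Fin M') (Fin M') (MvPolynomial (Fin n × Fin n) ℂ))
            (β' : Fin M' → Fin n),
            IsAffineDetRepr (perPoly (Fin n) ℂ) A' ∧
            ∀ a b (e : Fin n × Fin n), coeff (Finsupp.single e 1) (A' a b) ≠ 0 → e.2 = β' a) →
        ∃ j : Fin n, (1 + δ) * (M : ℝ) ≤ (n : ℝ) * ((Finset.univ.filter fun a => β a = j).card : ℝ)) :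
    ∃ δ : ℝ, 0 < δ ∧ ∃ n₀ : ℕ, ∀ n ≥ n₀,
      (1 + δ) * (rp (n + 1) : ℝ) ≤ ((n + 1 : ℕ) : ℝ) * ((rp (n + 1) : ℝ) - (rp n : ℝ)) := by
  obtain ⟨δ, hδ, n₀, hall⟩ := h
  refine ⟨δ, hδ, n₀ + 1, fun n hn => ?_⟩
  obtain ⟨⟨A, β, hA, hβ⟩, -⟩ := rp_attained_le (n := n + 1) (by omega)
  have hmin : ∀ M' < rp (n + 1),
      ¬ ∃ (A' : Matrix (Fin M') (Fin M') (MvPolynomial (Fin (n + 1) × Fin (n + 1)) ℂ))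
        (β' : Fin M' → Fin (n + 1)),
        IsAffineDetRepr (perPoly (Fin (n + 1)) ℂ) A' ∧
        ∀ a b (e : Fin (n + 1) × Fin (n + 1)), coeff (Finsupp.single e 1) (A' a b) ≠ 0 → e.2 = β' a :=
    fun M' hM' => not_mem_rpSet_of_lt_rp hM'
  obtain ⟨j, hj⟩ := hall (n + 1) (by omega) (rp (n + 1)) A β hA hβ hmin
  have hsum := rp_add_card_le (n := n) (by omega) A β hA hβ j
  have hcast : ((Finset.univ.filter fun a => β a = j).card : ℝ) ≤ (rp (n + 1) : ℝ) - (rp n : ℝ) := by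
    have h := (Nat.cast_le (α := ℝ)).mpr hsum
    push_cast at h
    linarith
  have hn0 : (0 : ℝ) ≤ ((n + 1 : ℕ) : ℝ) := Nat.cast_nonneg _
  calc (1 + δ) * (rp (n + 1) : ℝ)
      ≤ ((n + 1 : ℕ) : ℝ) * ((Finset.univ.filter fun a => β a = j).card : ℝ) := hj
    _ ≤ ((n + 1 : ℕ) : ℝ) * ((rp (n + 1) : ℝ) - (rp n : ℝ)) := mul_le_mul_of_nonneg_left hcast hn0

end

end Summit.ValiantsHypothesis.ValiantsHypothesis.Cruxes.DetqpThesis.FatRowRecursion
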